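import Mathlib
import HarnessLib
import Summits.AtomisticToContinuum.Crystallization.Theorems.PricedLinkCensusSoftFourRingsCapTypeData
import Summits.AtomisticToContinuum.Crystallization.Theorems.PricedLinkCensusSoftFourRingsTypePairs

/-!
# Soft four-rings, endgame: partners of a type-A vertex

Support file for `SoftFourRings` (route `PricedLinkCensus`, sub-problem `Crystallization`),
endgame steps (E1)–(E2) of the evidence file (§12.8), point-level form (see
`PricedLinkCensusSoftFourRingsTypeData` for the type data).  For type-A data `(a, b, c, d)` at `v`:

* `typeA_partner` — the `α`-partner `b` is of type A with data `(a, v, c, e)`, `e ∉ N[v]`;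
* `typeA_gamma` — the `γ`-partner `d` is of type A with `γ`-partner `v`;
* `typeA_wing` — the wing `a` is of type O with a bonded pair `{v, b}`.

**`Cap` variant** (seat c3 of stmt-AtomisticToContinuum-14234): identical to `PricedLinkCensusSoftFourRingsTypePartners`, except that the
global Tammes-13 hypothesis `(hT : musinTarasov2012_tammes_thirteen)` is replaced by the LOCAL covering
property of the twelve directions, `hT : ∀ p, ‖p‖ = 1 → ∃ x ∈ X, dist p x < 0.957` (no empty cap of
angular radius `57.18°`), which is all the two roots (`FacetCap`, `Interior`) ever used; the hT-free
lemmas are not repeated (the original file is imported for them).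
-/

namespace Summit.AtomisticToContinuum.Crystallization.Theorems.Cap

open Real RealInnerProductSpace Literature.Geometry.DiscreteGeometry

section Setting

open scoped Classical in
/-- **The `α`-partner of a type-A vertex** is of type A with data `(a, v, c, e)`, `e ∉ N[v]`. -/
theorem typeA_partner
    {X : Finset (EuclideanSpace ℝ (Fin 3))}
    {B : Finset (Finset (EuclideanSpace ℝ (Fin 3)))}
    (hT : ∀ p : EuclideanSpace ℝ (Fin 3), ‖p‖ = 1 → ∃ x ∈ X, dist p x < 0.957)
    (hX1 : ∀ y ∈ X, ‖y‖ = 1)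
    (hcard : X.card = 12)
    (hsepX : ∀ u ∈ X, ∀ u' ∈ X, u ≠ u' → ⟪u, u'⟫ ≤ 1 - 1 / (2 * (101 / 100 : ℝ) ^ 2))
    (hB : ∀ T ∈ B, ∃ u ∈ X, ∃ u' ∈ X, u ≠ u' ∧ 1 - (101 / 100 : ℝ) ^ 2 / 2 ≤ ⟪u, u'⟫ ∧ T = {u, u'})
    (hBcard : B.card = 24)
    (hdeg : ∀ v ∈ X, ∃ w : Fin 4 → EuclideanSpace ℝ (Fin 3), (∀ k, w k ∈ X) ∧ Function.Injective w ∧ (∀ k, w k ≠ v) ∧ (∀ k, ({v, w k} : Finset (EuclideanSpace ℝ (Fin 3))) ∈ B) ∧ ∀ y, ({v, y} : Finset (EuclideanSpace ℝ (Fin 3))) ∈ B → ∃ k, y = w k) {v a b c d : EuclideanSpace ℝ (Fin 3)}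
    (hN : ∀ y, ({v, y} : Finset (EuclideanSpace ℝ (Fin 3))) ∈ B ↔ (y = a ∨ y = b ∨ y = c ∨ y = d))
    (hd : a ≠ b ∧ a ≠ c ∧ a ≠ d ∧ b ≠ c ∧ b ≠ d ∧ c ≠ d)
    (hab : ({a, b} : Finset (EuclideanSpace ℝ (Fin 3))) ∈ B) (hbc : ({b, c} : Finset (EuclideanSpace ℝ (Fin 3))) ∈ B)
    (hac : ({a, c} : Finset (EuclideanSpace ℝ (Fin 3))) ∉ B) (hbd : ({b, d} : Finset (EuclideanSpace ℝ (Fin 3))) ∉ B) :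
    ∃ e, e ≠ v ∧ e ≠ a ∧ e ≠ b ∧ e ≠ c ∧ e ≠ d ∧
      (∀ y, ({b, y} : Finset (EuclideanSpace ℝ (Fin 3))) ∈ B ↔ (y = a ∨ y = v ∨ y = c ∨ y = e)) ∧
      (a ≠ v ∧ a ≠ c ∧ a ≠ e ∧ v ≠ c ∧ v ≠ e ∧ c ≠ e) ∧
      ({a, v} : Finset (EuclideanSpace ℝ (Fin 3))) ∈ B ∧ ({v, c} : Finset (EuclideanSpace ℝ (Fin 3))) ∈ B ∧
      ({a, c} : Finset (EuclideanSpace ℝ (Fin 3))) ∉ B ∧ ({a, e} : Finset (EuclideanSpace ℝ (Fin 3))) ∉ B ∧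
      ({v, e} : Finset (EuclideanSpace ℝ (Fin 3))) ∉ B ∧ ({c, e} : Finset (EuclideanSpace ℝ (Fin 3))) ∉ B := by
  obtain ⟨-, hac', -, -, -, -⟩ := hd
  have hvb : ({v, b} : Finset (EuclideanSpace ℝ (Fin 3))) ∈ B := (hN b).2 (Or.inr (Or.inl rfl))
  have hva : ({v, a} : Finset (EuclideanSpace ℝ (Fin 3))) ∈ B := (hN a).2 (Or.inl rfl)
  have hvc : ({v, c} : Finset (EuclideanSpace ℝ (Fin 3))) ∈ B := (hN c).2 (Or.inr (Or.inr (Or.inl rfl)))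
  have hbX : b ∈ X := (mem_of_mem_bonds hB hvb).2
  have hav : a ≠ v := (ne_of_mem_bonds hB hva).symm
  have hcv : c ≠ v := (ne_of_mem_bonds hB hvc).symm
  have hb_v : ({b, v} : Finset (EuclideanSpace ℝ (Fin 3))) ∈ B := by rw [Finset.pair_comm]; exact hvb
  have hb_a : ({b, a} : Finset (EuclideanSpace ℝ (Fin 3))) ∈ B := by rw [Finset.pair_comm]; exact hab
  rcases type_cases hT hX1 hcard hsepX hB hBcard hdeg hbX with
    ⟨a₂, b₂, c₂, d₂, hN₂, hd₂, -, -, hn₁, hn₂, hn₃, hn₄⟩ |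
    ⟨a₂, b₂, c₂, d₂, hN₂, hd₂, -, -, hn₁, hn₂, hn₃, hn₄⟩
  · ------------------------------------------------------------------ type A at `b`
    have hv₂ := (hN₂ v).1 hb_v
    have ha₂ := (hN₂ a).1 hb_a
    have hc₂ := (hN₂ c).1 hbc
    have h1 := bond_pair_typeA hn₁ hn₂ hn₃ hn₄ hv₂ ha₂ hav.symm hva
    have h2 := bond_pair_typeA hn₁ hn₂ hn₃ hn₄ hv₂ hc₂ hcv.symm hvc
    have hsame : ({v, a} : Finset (EuclideanSpace ℝ (Fin 3))) ≠ {v, c} := by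
      intro e
      rcases (mem_or_of_pair_eq e).2 with h | h
      · exact hav h
      · exact hac' h
    -- `v = b₂` and `{a, c} = {a₂, c₂}`
    have key : v = b₂ ∧ ((a = a₂ ∧ c = c₂) ∨ (a = c₂ ∧ c = a₂)) := by
      rcases h1 with h1 | h1 <;> rcases h2 with h2 | h2
      · exact absurd (h1.trans h2.symm) hsame
      · obtain ⟨hv1, ha1⟩ := mem_or_of_pair_eq h1
        obtain ⟨hv2, hc2⟩ := mem_or_of_pair_eq h2
        have hvb₂ : v = b₂ := by
          rcases hv1 with e1 | e1
          · rcases hv2 with e2 | e2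
            · exact e2
            · exact absurd (e1.symm.trans e2) hd₂.2.1
          · exact e1
        refine ⟨hvb₂, Or.inl ⟨?_, ?_⟩⟩
        · rcases ha1 with h | h
          · exact h
          · exact absurd (h.trans hvb₂.symm) hav
        · rcases hc2 with h | h
          · exact absurd (h.trans hvb₂.symm) hcv
          · exact h
      · obtain ⟨hv1, ha1⟩ := mem_or_of_pair_eq h1
        obtain ⟨hv2, hc2⟩ := mem_or_of_pair_eq h2
        have hvb₂ : v = b₂ := by
          rcases hv2 with e2 | e2
          · rcases hv1 with e1 | e1
            · exact e1
            · exact absurd (e2.symm.trans e1) hd₂.2.1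
          · exact e2
        refine ⟨hvb₂, Or.inr ⟨?_, ?_⟩⟩
        · rcases ha1 with h | h
          · exact absurd (h.trans hvb₂.symm) hav
          · exact h
        · rcases hc2 with h | h
          · exact h
          · exact absurd (h.trans hvb₂.symm) hcv
      · exact absurd (h1.trans h2.symm) hsame
    obtain ⟨hvb₂, hac₂⟩ := key
    have hbd₂ : ({b, d₂} : Finset (EuclideanSpace ℝ (Fin 3))) ∈ B := (hN₂ d₂).2 (Or.inr (Or.inr (Or.inr rfl)))
    have hd₂b : d₂ ≠ b := (ne_of_mem_bonds hB hbd₂).symm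
    have hd₂v : d₂ ≠ v := fun h => hd₂.2.2.2.2.1 (hvb₂.symm.trans h.symm)
    have hd₂a : d₂ ≠ a := by
      rcases hac₂ with ⟨h, -⟩ | ⟨h, -⟩
      · exact fun e => hd₂.2.2.1 (e.trans h).symm
      · exact fun e => hd₂.2.2.2.2.2 (e.trans h).symm
    have hd₂c : d₂ ≠ c := by
      rcases hac₂ with ⟨-, h⟩ | ⟨-, h⟩
      · exact fun e => hd₂.2.2.2.2.2 (e.trans h).symm
      · exact fun e => hd₂.2.2.1 (e.trans h).symm
    have hd₂d : d₂ ≠ d := fun h => hbd (h ▸ hbd₂)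
    have hvd₂ : ({v, d₂} : Finset (EuclideanSpace ℝ (Fin 3))) ∉ B := by rw [hvb₂]; exact hn₃
    have had₂ : ({a, d₂} : Finset (EuclideanSpace ℝ (Fin 3))) ∉ B := by
      rcases hac₂ with ⟨h, -⟩ | ⟨h, -⟩ <;> rw [h]
      · exact hn₂
      · exact hn₄
    have hcd₂ : ({c, d₂} : Finset (EuclideanSpace ℝ (Fin 3))) ∉ B := by
      rcases hac₂ with ⟨-, h⟩ | ⟨-, h⟩ <;> rw [h]
      · exact hn₄
      · exact hn₂
    refine ⟨d₂, hd₂v, hd₂a, hd₂b, hd₂c, hd₂d, ?_, ⟨hav, hac', hd₂a.symm, hcv.symm, hd₂v.symm,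
      hd₂c.symm⟩, by rw [Finset.pair_comm]; exact hva, hvc, hac, had₂, hvd₂, hcd₂⟩
    intro y
    rw [hN₂ y, hvb₂]
    rcases hac₂ with ⟨h1, h2⟩ | ⟨h1, h2⟩
    · rw [h1, h2]
    · rw [h1, h2]
      constructor
      · rintro (h | h | h | h)
        exacts [Or.inr (Or.inr (Or.inl h)), Or.inr (Or.inl h), Or.inl h, Or.inr (Or.inr (Or.inr h))]
      · rintro (h | h | h | h)
        exacts [Or.inr (Or.inr (Or.inl h)), Or.inr (Or.inl h), Or.inl h, Or.inr (Or.inr (Or.inr h))]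
  · ------------------------------------------------------------------ type O at `b`: impossible
    exfalso
    have hv₂ := (hN₂ v).1 hb_v
    have ha₂ := (hN₂ a).1 hb_a
    have hc₂ := (hN₂ c).1 hbc
    have h1 := bond_pair_typeO hn₁ hn₂ hn₃ hn₄ hv₂ ha₂ hav.symm hva
    have h2 := bond_pair_typeO hn₁ hn₂ hn₃ hn₄ hv₂ hc₂ hcv.symm hvc
    have hsame : ({v, a} : Finset (EuclideanSpace ℝ (Fin 3))) ≠ {v, c} := by
      intro e
      rcases (mem_or_of_pair_eq e).2 with h | h
      · exact hav h
      · exact hac' h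
    -- `v` would lie in both disjoint pairs `{a₂, b₂}` and `{c₂, d₂}`
    have hdisj : ∀ {p q : EuclideanSpace ℝ (Fin 3)}, ({v, p} : Finset (EuclideanSpace ℝ (Fin 3))) = {a₂, b₂} →
        ({v, q} : Finset (EuclideanSpace ℝ (Fin 3))) = {c₂, d₂} → False := by
      intro p q e1 e2
      rcases (mem_or_of_pair_eq e1).1 with h | h <;> rcases (mem_or_of_pair_eq e2).1 with h' | h'
      · exact hd₂.2.1 (h.symm.trans h')
      · exact hd₂.2.2.1 (h.symm.trans h')
      · exact hd₂.2.2.2.1 (h.symm.trans h')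
      · exact hd₂.2.2.2.2.1 (h.symm.trans h')
    rcases h1 with h1 | h1 <;> rcases h2 with h2 | h2
    · exact hsame (h1.trans h2.symm)
    · exact hdisj h1 h2
    · exact hdisj h2 h1
    · exact hsame (h1.trans h2.symm)

open scoped Classical in
/-- **The `γ`-partner of a type-A vertex** is of type A with `γ`-partner `v`. -/
theorem typeA_gamma
    {X : Finset (EuclideanSpace ℝ (Fin 3))}
    {B : Finset (Finset (EuclideanSpace ℝ (Fin 3)))}
    (hT : ∀ p : EuclideanSpace ℝ (Fin 3), ‖p‖ = 1 → ∃ x ∈ X, dist p x < 0.957)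
    (hX1 : ∀ y ∈ X, ‖y‖ = 1)
    (hcard : X.card = 12)
    (hsepX : ∀ u ∈ X, ∀ u' ∈ X, u ≠ u' → ⟪u, u'⟫ ≤ 1 - 1 / (2 * (101 / 100 : ℝ) ^ 2))
    (hB : ∀ T ∈ B, ∃ u ∈ X, ∃ u' ∈ X, u ≠ u' ∧ 1 - (101 / 100 : ℝ) ^ 2 / 2 ≤ ⟪u, u'⟫ ∧ T = {u, u'})
    (hBcard : B.card = 24)
    (hdeg : ∀ v ∈ X, ∃ w : Fin 4 → EuclideanSpace ℝ (Fin 3), (∀ k, w k ∈ X) ∧ Function.Injective w ∧ (∀ k, w k ≠ v) ∧ (∀ k, ({v, w k} : Finset (EuclideanSpace ℝ (Fin 3))) ∈ B) ∧ ∀ y, ({v, y} : Finset (EuclideanSpace ℝ (Fin 3))) ∈ B → ∃ k, y = w k) {v a b c d : EuclideanSpace ℝ (Fin 3)}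
    (hN : ∀ y, ({v, y} : Finset (EuclideanSpace ℝ (Fin 3))) ∈ B ↔ (y = a ∨ y = b ∨ y = c ∨ y = d))
    (had : ({a, d} : Finset (EuclideanSpace ℝ (Fin 3))) ∉ B) (hbd : ({b, d} : Finset (EuclideanSpace ℝ (Fin 3))) ∉ B)
    (hcd : ({c, d} : Finset (EuclideanSpace ℝ (Fin 3))) ∉ B) :
    ∃ a₃ b₃ c₃ : EuclideanSpace ℝ (Fin 3),
      (∀ y, ({d, y} : Finset (EuclideanSpace ℝ (Fin 3))) ∈ B ↔ (y = a₃ ∨ y = b₃ ∨ y = c₃ ∨ y = v)) ∧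
      (a₃ ≠ b₃ ∧ a₃ ≠ c₃ ∧ a₃ ≠ v ∧ b₃ ≠ c₃ ∧ b₃ ≠ v ∧ c₃ ≠ v) ∧
      ({a₃, b₃} : Finset (EuclideanSpace ℝ (Fin 3))) ∈ B ∧ ({b₃, c₃} : Finset (EuclideanSpace ℝ (Fin 3))) ∈ B ∧
      ({a₃, c₃} : Finset (EuclideanSpace ℝ (Fin 3))) ∉ B ∧ ({a₃, v} : Finset (EuclideanSpace ℝ (Fin 3))) ∉ B ∧
      ({b₃, v} : Finset (EuclideanSpace ℝ (Fin 3))) ∉ B ∧ ({c₃, v} : Finset (EuclideanSpace ℝ (Fin 3))) ∉ B := by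
  have hvd : ({v, d} : Finset (EuclideanSpace ℝ (Fin 3))) ∈ B := (hN d).2 (Or.inr (Or.inr (Or.inr rfl)))
  have hdX : d ∈ X := (mem_of_mem_bonds hB hvd).2
  have hd_v : ({d, v} : Finset (EuclideanSpace ℝ (Fin 3))) ∈ B := by rw [Finset.pair_comm]; exact hvd
  -- `v` and `d` have no common bond
  have hno : ∀ m, ({v, m} : Finset (EuclideanSpace ℝ (Fin 3))) ∈ B → ({d, m} : Finset (EuclideanSpace ℝ (Fin 3))) ∈ B → False := by
    intro m hvm hdm
    rcases (hN m).1 hvm with rfl | rfl | rfl | rfl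
    · exact had (by rw [Finset.pair_comm]; exact hdm)
    · exact hbd (by rw [Finset.pair_comm]; exact hdm)
    · exact hcd (by rw [Finset.pair_comm]; exact hdm)
    · exact (ne_of_mem_bonds hB hdm) rfl
  rcases type_cases hT hX1 hcard hsepX hB hBcard hdeg hdX with
    ⟨a₂, b₂, c₂, d₂, hN₂, hd₂, hB₁, hB₂, hn₁, hn₂, hn₃, hn₄⟩ |
    ⟨a₂, b₂, c₂, d₂, hN₂, hd₂, hB₁, hB₂, -, -, -, -⟩
  · -- type A at `d`: `v` must be the `γ`-partner `d₂`
    have hmem : ∀ y, (y = a₂ ∨ y = b₂ ∨ y = c₂ ∨ y = d₂) → ({d, y} : Finset (EuclideanSpace ℝ (Fin 3))) ∈ B :=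
      fun y hy => (hN₂ y).2 hy
    rcases (hN₂ v).1 hd_v with h | h | h | h
    · exact (hno b₂ (by rw [h]; exact hB₁) (hmem b₂ (Or.inr (Or.inl rfl)))).elim
    · exact (hno a₂ (by rw [h, Finset.pair_comm]; exact hB₁) (hmem a₂ (Or.inl rfl))).elim
    · exact (hno b₂ (by rw [h, Finset.pair_comm]; exact hB₂) (hmem b₂ (Or.inr (Or.inl rfl)))).elim
    · subst h
      exact ⟨a₂, b₂, c₂, hN₂, hd₂, hB₁, hB₂, hn₁, hn₂, hn₃, hn₄⟩
  · -- type O at `d`: every bond of `d` lies in a bonded pair, so `v` has a common bond with `d`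
    exfalso
    have hmem : ∀ y, (y = a₂ ∨ y = b₂ ∨ y = c₂ ∨ y = d₂) → ({d, y} : Finset (EuclideanSpace ℝ (Fin 3))) ∈ B :=
      fun y hy => (hN₂ y).2 hy
    rcases (hN₂ v).1 hd_v with h | h | h | h
    · exact hno b₂ (by rw [h]; exact hB₁) (hmem b₂ (Or.inr (Or.inl rfl)))
    · exact hno a₂ (by rw [h, Finset.pair_comm]; exact hB₁) (hmem a₂ (Or.inl rfl))
    · exact hno d₂ (by rw [h]; exact hB₂) (hmem d₂ (Or.inr (Or.inr (Or.inr rfl))))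
    · exact hno c₂ (by rw [h, Finset.pair_comm]; exact hB₂) (hmem c₂ (Or.inr (Or.inr (Or.inl rfl))))

open scoped Classical in
/-- **The wings of a type-A vertex are of type O**: type-O data `(v, b, x, y)` at the wing `a`,
with `x, y ∉ N[v]`. -/
theorem typeA_wing
    {X : Finset (EuclideanSpace ℝ (Fin 3))}
    {B : Finset (Finset (EuclideanSpace ℝ (Fin 3)))}
    (hT : ∀ p : EuclideanSpace ℝ (Fin 3), ‖p‖ = 1 → ∃ x ∈ X, dist p x < 0.957)
    (hX1 : ∀ y ∈ X, ‖y‖ = 1)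
    (hcard : X.card = 12)
    (hsepX : ∀ u ∈ X, ∀ u' ∈ X, u ≠ u' → ⟪u, u'⟫ ≤ 1 - 1 / (2 * (101 / 100 : ℝ) ^ 2))
    (hB : ∀ T ∈ B, ∃ u ∈ X, ∃ u' ∈ X, u ≠ u' ∧ 1 - (101 / 100 : ℝ) ^ 2 / 2 ≤ ⟪u, u'⟫ ∧ T = {u, u'})
    (hBcard : B.card = 24)
    (hdeg : ∀ v ∈ X, ∃ w : Fin 4 → EuclideanSpace ℝ (Fin 3), (∀ k, w k ∈ X) ∧ Function.Injective w ∧ (∀ k, w k ≠ v) ∧ (∀ k, ({v, w k} : Finset (EuclideanSpace ℝ (Fin 3))) ∈ B) ∧ ∀ y, ({v, y} : Finset (EuclideanSpace ℝ (Fin 3))) ∈ B → ∃ k, y = w k) {v a b c d : EuclideanSpace ℝ (Fin 3)}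
    (hN : ∀ y, ({v, y} : Finset (EuclideanSpace ℝ (Fin 3))) ∈ B ↔ (y = a ∨ y = b ∨ y = c ∨ y = d))
    (hd : a ≠ b ∧ a ≠ c ∧ a ≠ d ∧ b ≠ c ∧ b ≠ d ∧ c ≠ d)
    (hab : ({a, b} : Finset (EuclideanSpace ℝ (Fin 3))) ∈ B) (hbc : ({b, c} : Finset (EuclideanSpace ℝ (Fin 3))) ∈ B)
    (hac : ({a, c} : Finset (EuclideanSpace ℝ (Fin 3))) ∉ B) (had : ({a, d} : Finset (EuclideanSpace ℝ (Fin 3))) ∉ B)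
    (hbd : ({b, d} : Finset (EuclideanSpace ℝ (Fin 3))) ∉ B) :
    ∃ x y : EuclideanSpace ℝ (Fin 3),
      (∀ z, ({a, z} : Finset (EuclideanSpace ℝ (Fin 3))) ∈ B ↔ (z = v ∨ z = b ∨ z = x ∨ z = y)) ∧
      (v ≠ b ∧ v ≠ x ∧ v ≠ y ∧ b ≠ x ∧ b ≠ y ∧ x ≠ y) ∧
      ({v, b} : Finset (EuclideanSpace ℝ (Fin 3))) ∈ B ∧ ({x, y} : Finset (EuclideanSpace ℝ (Fin 3))) ∈ B ∧
      ({v, x} : Finset (EuclideanSpace ℝ (Fin 3))) ∉ B ∧ ({v, y} : Finset (EuclideanSpace ℝ (Fin 3))) ∉ B ∧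
      ({b, x} : Finset (EuclideanSpace ℝ (Fin 3))) ∉ B ∧ ({b, y} : Finset (EuclideanSpace ℝ (Fin 3))) ∉ B ∧
      (x ≠ a ∧ x ≠ c ∧ x ≠ d ∧ y ≠ a ∧ y ≠ c ∧ y ≠ d) := by
  have hva : ({v, a} : Finset (EuclideanSpace ℝ (Fin 3))) ∈ B := (hN a).2 (Or.inl rfl)
  have hvb : ({v, b} : Finset (EuclideanSpace ℝ (Fin 3))) ∈ B := (hN b).2 (Or.inr (Or.inl rfl))
  have haX : a ∈ X := (mem_of_mem_bonds hB hva).2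
  have hav : a ≠ v := (ne_of_mem_bonds hB hva).symm
  have hbv : b ≠ v := (ne_of_mem_bonds hB hvb).symm
  have ha_v : ({a, v} : Finset (EuclideanSpace ℝ (Fin 3))) ∈ B := by rw [Finset.pair_comm]; exact hva
  -- neighbours of `a` other than `v, b` avoid `N[v]`
  have hout : ∀ x, ({a, x} : Finset (EuclideanSpace ℝ (Fin 3))) ∈ B → x ≠ v → x ≠ b → x ≠ a ∧ x ≠ c ∧ x ≠ d := by
    intro x hx _ _
    refine ⟨(ne_of_mem_bonds hB hx).symm, fun h => hac (h ▸ hx), fun h => had (h ▸ hx)⟩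
  rcases type_cases hT hX1 hcard hsepX hB hBcard hdeg haX with
    ⟨a₂, b₂, c₂, d₂, hN₂, hd₂, hB₁, hB₂, hn₁, hn₂, hn₃, hn₄⟩ |
    ⟨a₂, b₂, c₂, d₂, hN₂, hd₂, hB₁, hB₂, hn₁, hn₂, hn₃, hn₄⟩
  · ------------------------------------------------------------- type A at `a`: impossible
    exfalso
    have hv₂ := (hN₂ v).1 ha_v
    have hb₂ := (hN₂ b).1 hab
    -- a common bond of `a` and `v` is `b`; a common bond of `a` and `b` is `v`
    have hNva : ∀ m, ({v, m} : Finset (EuclideanSpace ℝ (Fin 3))) ∈ B → ({a, m} : Finset (EuclideanSpace ℝ (Fin 3))) ∈ B → m = b := by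
      intro m hvm ham
      rcases (hN m).1 hvm with rfl | rfl | rfl | rfl
      · exact absurd rfl (ne_of_mem_bonds hB ham)
      · rfl
      · exact absurd ham hac
      · exact absurd ham had
    obtain ⟨e, -, -, -, -, -, hNb, -, -, -, -, hae, -, -⟩ :=
      typeA_partner hT hX1 hcard hsepX hB hBcard hdeg hN hd hab hbc hac hbd
    have hNba : ∀ m, ({b, m} : Finset (EuclideanSpace ℝ (Fin 3))) ∈ B → ({a, m} : Finset (EuclideanSpace ℝ (Fin 3))) ∈ B → m = v := by
      intro m hbm ham
      rcases (hNb m).1 hbm with rfl | rfl | rfl | rfl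
      · exact absurd rfl (ne_of_mem_bonds hB ham)
      · rfl
      · exact absurd ham hac
      · exact absurd ham hae
    have hmem : ∀ y, (y = a₂ ∨ y = b₂ ∨ y = c₂ ∨ y = d₂) → ({a, y} : Finset (EuclideanSpace ℝ (Fin 3))) ∈ B :=
      fun y hy => (hN₂ y).2 hy
    have ha₂a := hmem a₂ (Or.inl rfl)
    have hc₂a := hmem c₂ (Or.inr (Or.inr (Or.inl rfl)))
    rcases bond_pair_typeA hn₁ hn₂ hn₃ hn₄ hv₂ hb₂ hbv.symm hvb with h | h
    · obtain ⟨hv' | hv', hb' | hb'⟩ := mem_or_of_pair_eq h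
      · exact hbv (hb'.trans hv'.symm)
      · -- `v = a₂`, `b = b₂`: `c₂` is a common bond of `a` and `b`
        have : c₂ = v := hNba c₂ (by rw [hb']; exact hB₂) hc₂a
        exact hd₂.2.1 (hv'.symm.trans this.symm)
      · -- `v = b₂`, `b = a₂`: `c₂` is a common bond of `a` and `v`
        have : c₂ = b := hNva c₂ (by rw [hv']; exact hB₂) hc₂a
        exact hd₂.2.1 (hb'.symm.trans this.symm)
      · exact hbv (hb'.trans hv'.symm)
    · obtain ⟨hv' | hv', hb' | hb'⟩ := mem_or_of_pair_eq h
      · exact hbv (hb'.trans hv'.symm)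
      · -- `v = b₂`, `b = c₂`: `a₂` is a common bond of `a` and `v`
        have : a₂ = b := hNva a₂ (by rw [hv', Finset.pair_comm]; exact hB₁) ha₂a
        exact hd₂.2.1 (this.trans hb')
      · -- `v = c₂`, `b = b₂`: `a₂` is a common bond of `a` and `b`
        have : a₂ = v := hNba a₂ (by rw [hb', Finset.pair_comm]; exact hB₁) ha₂a
        exact hd₂.2.1 (this.trans hv')
      · exact hbv (hb'.trans hv'.symm)
  · ------------------------------------------------------------- type O at `a`
    have hv₂ := (hN₂ v).1 ha_v
    have hb₂ := (hN₂ b).1 hab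
    have hmem : ∀ y, (y = a₂ ∨ y = b₂ ∨ y = c₂ ∨ y = d₂) → ({a, y} : Finset (EuclideanSpace ℝ (Fin 3))) ∈ B :=
      fun y hy => (hN₂ y).2 hy
    have ha₂a := hmem a₂ (Or.inl rfl)
    have hb₂a := hmem b₂ (Or.inr (Or.inl rfl))
    have hc₂a := hmem c₂ (Or.inr (Or.inr (Or.inl rfl)))
    have hd₂a := hmem d₂ (Or.inr (Or.inr (Or.inr rfl)))
    rcases bond_pair_typeO hn₁ hn₂ hn₃ hn₄ hv₂ hb₂ hbv.symm hvb with h | h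
    · obtain ⟨hv' | hv', hb' | hb'⟩ := mem_or_of_pair_eq h
      · exact absurd (hb'.trans hv'.symm) hbv
      · subst hv' hb'
        exact ⟨c₂, d₂, hN₂, hd₂, hvb, hB₂, hn₁, hn₂, hn₃, hn₄,
          (hout c₂ hc₂a hd₂.2.1.symm hd₂.2.2.2.1.symm).1,
          (hout c₂ hc₂a hd₂.2.1.symm hd₂.2.2.2.1.symm).2.1,
          (hout c₂ hc₂a hd₂.2.1.symm hd₂.2.2.2.1.symm).2.2,
          (hout d₂ hd₂a hd₂.2.2.1.symm hd₂.2.2.2.2.1.symm).1,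
          (hout d₂ hd₂a hd₂.2.2.1.symm hd₂.2.2.2.2.1.symm).2.1,
          (hout d₂ hd₂a hd₂.2.2.1.symm hd₂.2.2.2.2.1.symm).2.2⟩
      · subst hv' hb'
        refine ⟨c₂, d₂, fun z => (hN₂ z).trans or4_swap12, ⟨hd₂.1.symm, hd₂.2.2.2.1,
          hd₂.2.2.2.2.1, hd₂.2.1, hd₂.2.2.1, hd₂.2.2.2.2.2⟩, hvb, hB₂, hn₃, hn₄, hn₁, hn₂,
          (hout c₂ hc₂a hd₂.2.2.2.1.symm hd₂.2.1.symm).1,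
          (hout c₂ hc₂a hd₂.2.2.2.1.symm hd₂.2.1.symm).2.1,
          (hout c₂ hc₂a hd₂.2.2.2.1.symm hd₂.2.1.symm).2.2,
          (hout d₂ hd₂a hd₂.2.2.2.2.1.symm hd₂.2.2.1.symm).1,
          (hout d₂ hd₂a hd₂.2.2.2.2.1.symm hd₂.2.2.1.symm).2.1,
          (hout d₂ hd₂a hd₂.2.2.2.2.1.symm hd₂.2.2.1.symm).2.2⟩
      · exact absurd (hb'.trans hv'.symm) hbv
    · obtain ⟨hv' | hv', hb' | hb'⟩ := mem_or_of_pair_eq h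
      · exact absurd (hb'.trans hv'.symm) hbv
      · subst hv' hb'
        refine ⟨a₂, b₂, fun z => (hN₂ z).trans or4_rot2, ⟨hd₂.2.2.2.2.2, hd₂.2.1.symm,
          hd₂.2.2.2.1.symm, hd₂.2.2.1.symm, hd₂.2.2.2.2.1.symm, hd₂.1⟩, hvb, hB₁,
          by rw [Finset.pair_comm]; exact hn₁, by rw [Finset.pair_comm]; exact hn₃,
          by rw [Finset.pair_comm]; exact hn₂, by rw [Finset.pair_comm]; exact hn₄,
          (hout a₂ ha₂a hd₂.2.1 hd₂.2.2.1).1,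
          (hout a₂ ha₂a hd₂.2.1 hd₂.2.2.1).2.1,
          (hout a₂ ha₂a hd₂.2.1 hd₂.2.2.1).2.2,
          (hout b₂ hb₂a hd₂.2.2.2.1 hd₂.2.2.2.2.1).1,
          (hout b₂ hb₂a hd₂.2.2.2.1 hd₂.2.2.2.2.1).2.1,
          (hout b₂ hb₂a hd₂.2.2.2.1 hd₂.2.2.2.2.1).2.2⟩
      · subst hv' hb'
        refine ⟨a₂, b₂, fun z => ((hN₂ z).trans or4_rot2).trans or4_swap12, ⟨hd₂.2.2.2.2.2.symm,
          hd₂.2.2.1.symm, hd₂.2.2.2.2.1.symm, hd₂.2.1.symm, hd₂.2.2.2.1.symm, hd₂.1⟩, hvb, hB₁,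
          by rw [Finset.pair_comm]; exact hn₂, by rw [Finset.pair_comm]; exact hn₄,
          by rw [Finset.pair_comm]; exact hn₁, by rw [Finset.pair_comm]; exact hn₃,
          (hout a₂ ha₂a hd₂.2.2.1 hd₂.2.1).1,
          (hout a₂ ha₂a hd₂.2.2.1 hd₂.2.1).2.1,
          (hout a₂ ha₂a hd₂.2.2.1 hd₂.2.1).2.2,
          (hout b₂ hb₂a hd₂.2.2.2.2.1 hd₂.2.2.2.1).1,
          (hout b₂ hb₂a hd₂.2.2.2.2.1 hd₂.2.2.2.1).2.1,
          (hout b₂ hb₂a hd₂.2.2.2.2.1 hd₂.2.2.2.1).2.2⟩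
      · exact absurd (hb'.trans hv'.symm) hbv

end Setting

end Summit.AtomisticToContinuum.Crystallization.Theorems.Cap
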